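import Summits.AnomalousDissipation.AnomalousDissipation.Theses.CoherentFraction

/-!
# Glue of the SpectralHullCut split of `CoherentFraction.TameEulerClimatesPlanar` (stmt-AnomalousDissipation-27427)

Sorry-free proof of the GLUE item `CoherentFraction.SpectralHullGlue` (stmt-AnomalousDissipation-27873, route
route-AnomalousDissipation-CoherentFraction rev5): `FiniteModeRootsPlanar → ExtremeClimatesPlanarBeyondFiniteModes →
ExtremeClimateReduction → TameEulerClimatesPlanar`, plus the exactness of the cut
`TameEulerClimatesPlanar ↔ FiniteModeRootsPlanar ∧ ExtremeClimatesPlanarBeyondFiniteModes ∧ ExtremeClimateReduction`.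
Mechanism (pure logic + Dirac bookkeeping): `ExtremeClimateReduction` reduces the planarity conclusion to extreme points of the
tame stationary class; an extreme point is either a Dirac mass at a finite-mode root (handled by `FiniteModeRootsPlanar` after
`ae_dirac_eq` / `integral_dirac`) or not (handled by `ExtremeClimatesPlanarBeyondFiniteModes`).  No facts are asserted here.
Source: decomp-ad cell, lens-4 g17 node «SpectralHullCut» (kernel `run/shared/lean/pub/decomp-ad/decomp-ad-lens-4/g17/SpectralHullCut.lean`,
by-name certificate `g17/pkg/ByName_g17.lean`, theorems `tree_spectralHull_split` / `tree_exact_split_TEP`); landed by the cell's prover seat.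
-/

set_option linter.dupNamespace false

noncomputable section

open scoped BigOperators Topology ENNReal
open Filter MeasureTheory

namespace Summit.AnomalousDissipation.AnomalousDissipation.Theorems.SpectralHullGlue

open Summit.AnomalousDissipation.AnomalousDissipation.Theses
open Summit.AnomalousDissipation.AnomalousDissipation.Theses.CoherentFraction

/-- Singletons of the energy space are measurable (closed in a metrisable Borel space); needed for `ae_dirac_eq`. [folklore] -/
theorem measurableSingletonClass_energySpace :
    MeasurableSingletonClass ↥(Literature.Analysis.FunctionSpaces.Torus.energySpace (Fin 3)) :=
  ⟨fun _ => isClosed_singleton.measurableSet⟩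

/-- The three pieces of the SpectralHullCut recombine to `TameEulerClimatesPlanar` (27427). [folklore] -/
theorem tameEulerClimatesPlanar_of_pieces (hF : FiniteModeRootsPlanar) (hT : ExtremeClimatesPlanarBeyondFiniteModes)
    (hER : ExtremeClimateReduction) : TameEulerClimatesPlanar := by
  haveI := measurableSingletonClass_energySpace
  intro m R μ₀ hμ₀ htame₀ hstat₀
  refine hER m R (fun μ hext => ?_) μ₀ hμ₀ htame₀ hstat₀
  obtain ⟨hμ, htame, hstat⟩ := hext.1
  by_cases hd : ∃ v : ↥(Literature.Analysis.FunctionSpaces.Torus.energySpace (Fin 3)),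
      (∃ N : ℕ, ((v : MeasureTheory.Lp (EuclideanSpace ℝ (Fin 3)) 2 (MeasureTheory.volume : MeasureTheory.Measure (UnitAddTorus (Fin 3)))) : UnitAddTorus (Fin 3) → EuclideanSpace ℝ (Fin 3)) =ᵐ[MeasureTheory.volume] Literature.Analysis.FunctionSpaces.Torus.fourierTruncate N ((v : MeasureTheory.Lp (EuclideanSpace ℝ (Fin 3)) 2 (MeasureTheory.volume : MeasureTheory.Measure (UnitAddTorus (Fin 3)))) : UnitAddTorus (Fin 3) → EuclideanSpace ℝ (Fin 3))) ∧ μ = MeasureTheory.Measure.dirac v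
  · obtain ⟨v, hfin, rfl⟩ := hd
    have htame' := htame
    rw [MeasureTheory.ae_dirac_eq] at htame'
    have hv := hF m R v hfin (Filter.eventually_pure.mp htame')
      (fun Φ => by have := hstat Φ; rwa [MeasureTheory.integral_dirac] at this)
    rw [MeasureTheory.ae_dirac_eq]
    exact Filter.eventually_pure.mpr hv
  · exact hT m R μ hext hd

/-- EXACTNESS of the SpectralHullCut: `TameEulerClimatesPlanar` (27427) ⟺ the conjunction of its three pieces
(27870 ∧ 27871 ∧ 27872). [folklore] -/
theorem tameEulerClimatesPlanar_iff_pieces :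
    TameEulerClimatesPlanar ↔ (FiniteModeRootsPlanar ∧ ExtremeClimatesPlanarBeyondFiniteModes ∧ ExtremeClimateReduction) :=
  ⟨fun h => ⟨fun m R v hfin hR hstat => by
      haveI := measurableSingletonClass_energySpace
      have := h m R (MeasureTheory.Measure.dirac v) inferInstance
        (by rw [MeasureTheory.ae_dirac_eq]; exact Filter.eventually_pure.mpr hR)
        (fun Φ => by rw [MeasureTheory.integral_dirac]; exact hstat Φ)
      rw [MeasureTheory.ae_dirac_eq] at this
      exact Filter.eventually_pure.mp this,
    fun m R μ hext _ => h m R μ hext.1.1 hext.1.2.1 hext.1.2.2,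
    fun m R _ μ hμ htame hstat => h m R μ hμ htame hstat⟩,
   fun h => tameEulerClimatesPlanar_of_pieces h.1 h.2.1 h.2.2⟩

/-- The GLUE item `CoherentFraction.SpectralHullGlue` (stmt-AnomalousDissipation-27873) holds. [folklore] -/
theorem spectralHullGlue_holds : SpectralHullGlue :=
  fun hF hT hER => tameEulerClimatesPlanar_iff_pieces.mpr ⟨hF, hT, hER⟩

end Summit.AnomalousDissipation.AnomalousDissipation.Theorems.SpectralHullGlue

end
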